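import Literature.IUT.HodgeArakelov.MonoThetaProjectiveNaturalTheta
import Literature.AnabelianGeometry.AbsoluteAnabelian.ZHatCompletionAdicCompleteness

/-!
# Bridge B8, the limit step of [IUTchII] Prop. 1.5 (iii) for the natural system: `(l·Δ_Θ)(Π^tp_{X̲̲}) ⥲ lim_M μ_M`

abc-iut cell, layer L6, seat abc-iut-L6-d7 (gen 2); DAG node **IUTchII:Prop1.5(iii)**; sub-DAG
`plan/L6/SUBDAG-IUTchII-Prop-15.md` row `Prop-15.iii.L03` ("passage to the limit … classical input:
`Ẑ → lim_{M ∈ (ℕ≥1, ∣)} Ẑ/MẐ` is bijective"). S. Mochizuki, *Inter-universal Teichmüller theory II*, kurims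
manuscript (Dec. 2020), Prop. 1.5 (iii) p. 29: "The projective system of exterior cyclotomes … determines a projective
limit exterior cyclotome `Π_μ(M^Θ_*)` which is equipped with a uniquely determined cyclotomic rigidity isomorphism
`(l·Δ_Θ)(M^Θ_*) ⥲ Π_μ(M^Θ_*)` [i.e., obtained by applying the cyclotomic rigidity isomorphisms of Definition 1.1, (ii),
to the various members of the projective system `M^Θ_*`]" [claim: Mochizuki2012, status: disputed] (IUTchII §1 Prop 1.5 (iii), kurims p.29).

PROOF-ONLY file (no definitions), the NATURAL-SYSTEM side only. abc-iut-w5-d233's inhabitant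
`EtaleLevels.thetaEnvDataNatural` of abc-iut-L6-t1's `ThetaEnvData naturalSystem` (`MonoThetaProjectiveNaturalTheta`)
carries ONE explicit hypothesis `hlim : Function.Bijective toMuLim` ("`(l·Δ_Θ) ⥲ lim_M μ_M`", [EtTh] §1 p. 12
`Δ_Θ ≅ Ẑ(1)` in the form the limit needs). This file DISCHARGES it from the parameter
`hZ : (l·Δ_Θ)/thetaKer ≃* Ẑ` of the B8 files (abstract group isomorphism), by the classical brick
`Literature.AnabelianGeometry.AbsoluteAnabelian.ZHatCompletion.injective_and_range_eq_of_mulEquiv` (`Ẑ` is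
`M`-adically separated and complete — Cantor intersection in the compact group `Ẑ` + `⋂_k p^k ℤ_p = 0` — stated for
any `G ≃* Ẑ` and any level system `f_M : G →* P_M` with kernels the `M`-th powers and transitions
`t ∘ f_{M'} = f_M`), applied at `f_M := thetaModQuot` (the mod-`M` reductions `(l·Δ_Θ) ↠ μ_M`) and `t := MuN.red`:

* `EtaleLevels.thetaModQuot_rigidData_eq_one_iff` — the level-`M` kernel: `(l·Δ_Θ) ↠ μ_M` kills exactly the
  `M`-th powers (abc-iut-L6-d6's `thetaModPow_injective`, i.e. `lDeltaModEquiv : (l·Δ_Θ) ⊗ ℤ/M ⥲ μ_M`, [EtTh]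
  Cor. 2.19 (i), + commutativity of `l·Δ_Θ ≅ Ẑ`);
* **`EtaleLevels.toMuLim_bijective`** — `(l·Δ_Θ)(Π^tp_{X̲̲}) ⥲ lim_M μ_M` (abc-iut-w5-d233's `hlim`), from `hZ` alone;
* `EtaleLevels.nonempty_thetaEnvDataNatural_noLim`, `EtaleLevels.prop15_ii_iii_naturalSystem_noLim`,
  `EtaleLevels.prop15_ii_iii_naturalSystem_of_cor218_i_noLim` — abc-iut-w5-d233's theorems WITHOUT `hlim`.

The `modelSystem` side (abc-iut-w4-d030's `hlim : Function.Bijective rigidLimHom`) is the node holder's own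
`EtaleLevels.bijective_rigidLimHom` (`MonoThetaProjectiveThetaEnvProofs`, via finite quotients of `Ẑ`); the two
systems agree by abc-iut-w4-d038's `naturalSystem_eq_modelSystem` and the two `hlim`s by abc-iut-w5-d233's bridge —
this file is an independent route for the natural-system binder, nothing more. HONEST FRAMING: constructions over the
cell's own [EtTh]-side objects; nothing disputed is asserted ([IUTchII] claim key `Mochizuki2012`, DISPUTED); no side
is taken on [IUTchIII] Cor. 3.12; typed ≠ discharged.
-/

noncomputable section

namespace Literature.IUT.HodgeArakelov

open Literature.AnabelianGeometry.EtaleTheta Literature.AnabelianGeometry.SemiGraphs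
open Literature.AnabelianGeometry.AbsoluteAnabelian
open scoped Literature.AnabelianGeometry.EtaleTheta

namespace EtaleLevels

variable {p : ℕ} [Fact p.Prime] {D : Literature.AnabelianGeometry.EtaleTheta.ThetaSetting p}
  {E : D.EtaleThetaData} {l : ℕ} (C : E.DoubleUnderline l) (hC : D.Compat) (hS : D.Sec2Hyps)
  (hl : l.Prime) (hp2 : p ≠ 2) (hpl : p ≠ l) (hζ : ∃ ζ : D.K, IsPrimitiveRoot ζ (4 * l))
  (mods : ∀ M : ℕ+, D.CyclotomeMod l M)
  (f : contCocycles D.toTheta D.DeltaTheta C.GtpYdduu) (hf : f ∈ C.rootCocycles hC)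
  (hmods : ∀ (M M' : ℕ+) (h : (M : ℕ) ∣ (M' : ℕ)) (x : D.lDeltaTheta l),
    MuN.red p M M' h ((mods M').red x) = (mods M).red x)
  (h15 : Literature.AnabelianGeometry.EtaleTheta.ThetaSetting.Prop15iii E hC) (L : C.CuspLabels)
  (hZ : ∀ M : ℕ+, Nonempty (ModelCyclotomes.lDeltaQuot (C.rigidData (mods M) hC hS h15 L) ≃*
    Literature.IUT.HodgeTheaters.ZHat))

/-! ## The level-`M` kernels: `(l·Δ_Θ) ↠ μ_M` kills exactly the `M`-th powers -/

include hZ in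
/-- **The mod-`M` reduction `(l·Δ_Θ)(Π) ↠ μ_M` kills exactly the `M`-th powers**: B8-5a's `thetaModQuot` of L2-t8's
level-`M` rigidity data vanishes on `a ∈ (l·Δ_Θ)/thetaKer` iff `a` is an `M`-th power (`lDeltaModEquiv :
(l·Δ_Θ) ⊗ ℤ/Mℤ ⥲ μ_M` is an isomorphism from the quotient by the normal closure of the `M`-th powers; in the
commutative group `(l·Δ_Θ)/thetaKer ≅ Ẑ` that normal closure is the set of `M`-th powers).
[cite: MochizukiEtTh2009, Cor 2.19(i) p.64] -/
theorem thetaModQuot_rigidData_eq_one_iff (M : ℕ+) (a : (EtaleThetaDataOfSetting.lDeltaSubquotient C).carrier) :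
    ModelCyclotomes.thetaModQuot (C.rigidData (mods M) hC hS h15 L) a = 1 ↔
      ∃ b : (EtaleThetaDataOfSetting.lDeltaSubquotient C).carrier, b ^ (M : ℕ) = a := by
  obtain ⟨e⟩ := hZ M
  rw [← ModelCyclotomes.thetaModPow_mk,
    (ModelCyclotomes.thetaModPow_injective (C.rigidData (mods M) hC hS h15 L)).eq_iff' (map_one _),
    QuotientGroup.eq_one_iff]
  exact ZHatCompletion.mem_normalClosure_range_pow_iff_of_mulEquiv e (M : ℕ) a

/-- `thetaModQuot` at level `M` is onto `μ_M` (B8-5a). [cite: MochizukiEtTh2009, Cor 2.19(i) p.64] -/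
theorem thetaModQuot_rigidData_surjective (M : ℕ+) :
    Function.Surjective (ModelCyclotomes.thetaModQuot (C.rigidData (mods M) hC hS h15 L) :
      (EtaleThetaDataOfSetting.lDeltaSubquotient C).carrier → MuN p M) :=
  ModelCyclotomes.thetaModQuot_surjective (C.rigidData (mods M) hC hS h15 L)

/-! ## `(l·Δ_Θ)(Π^tp_{X̲̲}) ⥲ lim_M μ_M` (abc-iut-w5-d233's `hlim`) -/

include hZ in
/-- **`toMuLim` is bijective: `(l·Δ_Θ)(Π^tp_{X̲̲}) ⥲ lim_M μ_M`** — the hypothesis `hlim` of abc-iut-w5-d233's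
`thetaEnvDataNatural` / `prop15_ii_iii_naturalSystem`, DISCHARGED from `hZ : (l·Δ_Θ)/thetaKer ≃* Ẑ`: injective by the
`M`-adic separatedness of `Ẑ`, surjective onto the compatible families by its `M`-adic completeness (the level maps
are the surjections `(l·Δ_Θ) ↠ μ_M` with kernels the `M`-th powers, compatible under the power maps `MuN.red`).
[claim: Mochizuki2012, status: disputed] (IUTchII §1 Prop 1.5 (iii), kurims p.29) -/
theorem toMuLim_bijective : Function.Bijective (toMuLim C hC hS mods hmods h15 L) := by
  obtain ⟨e⟩ := hZ 1
  have key := ZHatCompletion.injective_and_range_eq_of_mulEquiv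
    (G := (EtaleThetaDataOfSetting.lDeltaSubquotient C).carrier) e (P := fun M : ℕ+ => MuN p M)
    (fun M => ModelCyclotomes.thetaModQuot (C.rigidData (mods M) hC hS h15 L))
    (fun M a => thetaModQuot_rigidData_eq_one_iff C hC hS mods h15 L hZ M a)
    (fun M => thetaModQuot_rigidData_surjective C hC hS mods h15 L M)
    (fun M M' h => MuN.red p M M' h)
    (fun M M' h a => (toMuLim C hC hS mods hmods h15 L a).2 M M' h)
  refine ⟨fun a b hab => key.1 (congrArg Subtype.val hab), fun y => ?_⟩
  obtain ⟨a, ha⟩ := ((Set.ext_iff.1 key.2) (y.1 : ∀ M : ℕ+, MuN p M)).2 y.2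
  exact ⟨a, Subtype.ext ha⟩

/-! ## The unconditional forms of abc-iut-w5-d233's theorems (node IUTchII:Prop1.5(iii) over `naturalSystem`) -/

/-- **Non-vacuity of `ThetaEnvData naturalSystem`, WITHOUT `hlim`** (abc-iut-w5-d233's `thetaEnvDataNatural` with its
limit hypothesis discharged by `toMuLim_bijective`). [claim: Mochizuki2012, status: disputed] (IUTchII §1 Prop 1.5 (iii), kurims pp.29-30) -/
theorem nonempty_thetaEnvDataNatural_noLim (hchar : EtaleThetaDataOfSetting.PiYddCharacteristic C) :
    Nonempty (ThetaEnvData (naturalSystem C hC hS hl hp2 hpl hζ mods f hf hmods h15 L hZ)) :=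
  ⟨thetaEnvDataNatural C hC hS hl hp2 hpl hζ mods f hf hmods h15 L hZ hchar
    (toMuLim_bijective C hC hS mods hmods h15 L hZ)⟩

/-- **[IUTchII] Prop. 1.5 (ii)+(iii) for the natural system, WITHOUT `hlim`** (abc-iut-w5-d233's
`prop15_ii_iii_naturalSystem` with `hlim` discharged): conditional only on `ThetaEnvData.Cor218_iv_surjective`, the
`Π^tp_{Y̲̲}`-stability clause `hY` and (H1) `PiYddCharacteristic`. [claim: Mochizuki2012, status: disputed] (IUTchII §1 Prop 1.5 (ii)(iii), kurims pp.29-30) -/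
theorem prop15_ii_iii_naturalSystem_noLim
    (hsurj : ∀ M : ℕ+, (levelData C hC hS mods M).Cor218_iv_surjective)
    (hY : ∀ (M : ℕ+) (γ : (levelData C hC hS mods M).PiX ≃ₜ* (levelData C hC hS mods M).PiX),
      (levelData C hC hS mods M).PiY.map γ.toMulEquiv.toMonoidHom = (levelData C hC hS mods M).PiY)
    (hchar : EtaleThetaDataOfSetting.PiYddCharacteristic C) :
    Prop15_ii_iii (naturalSystem C hC hS hl hp2 hpl hζ mods f hf hmods h15 L hZ) :=
  prop15_ii_iii_naturalSystem C hC hS hl hp2 hpl hζ mods f hf hmods h15 L hZ hsurj hY hchar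
    (toMuLim_bijective C hC hS mods hmods h15 L hZ)

/-- **[IUTchII] Prop. 1.5 (ii)+(iii) for the natural system, NAMED-FACT form WITHOUT `hlim`**: modulo, BY NAME,
`ThetaEnvData.Cor218_iv_surjective` (F-0639, all levels) and `RigidData.Cor218_i` at level `1` (F-0620 class) only
(abc-iut-w5-d233's `prop15_ii_iii_naturalSystem_of_cor218_i` with `hlim` discharged).
[claim: Mochizuki2012, status: disputed] (IUTchII §1 Prop 1.5 (ii)(iii), kurims pp.29-30) -/
theorem prop15_ii_iii_naturalSystem_of_cor218_i_noLim
    (hsurj : ∀ M : ℕ+, (levelData C hC hS mods M).Cor218_iv_surjective)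
    (h218i : (C.rigidData (mods 1) hC hS h15 L).Cor218_i) :
    Prop15_ii_iii (naturalSystem C hC hS hl hp2 hpl hζ mods f hf hmods h15 L hZ) :=
  prop15_ii_iii_naturalSystem_of_cor218_i C hC hS hl hp2 hpl hζ mods f hf hmods h15 L hZ hsurj h218i
    (toMuLim_bijective C hC hS mods hmods h15 L hZ)

end EtaleLevels

end Literature.IUT.HodgeArakelov

end
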